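import Summits.KontsevichZagierPeriods.KontsevichZagierPeriods.Theorems.UnfoldedStokesDefs
import Literature.NumberTheory.Transcendental.KZProductIdeal
import Literature.NumberTheory.Transcendental.KZLogCalculusProofs
import Mathlib.GroupTheory.Perm.Basic

/-!
# `StokesGeneration` (stmt-KontsevichZagierPeriods-3586), line `fibrewise_stokes` — closure properties of the S2 class, I

The residual S2 of the line (`FibrewiseStokesGenerationConjecture`) says that every bounded closed-cube integrand of value
`0` is FIBREWISE-STOKES DECOMPOSABLE — the package named `FibStokesDecomposable M h` in the route's definitions file
(`Theorems/UnfoldedStokesDefs.lean`). This file starts the algebra of that class: it contains every single fibrewise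
Stokes element (`fibStokesDecomposable_element`), is stable under negation (`fibStokesDecomposable_neg`) and under
COORDINATE PERMUTATIONS (`fibStokesDecomposable_perm`: extend the permutation to the padded cube by the identity on the
padding coordinates, `Equiv.Perm.extendDomain`; relabel primitives, kink sets and the null set; the carried
representations are the coordinate relabellings `KZ.IntegralRep.reindex`, and coordinate permutations preserve Lebesgue
measure). Padding, sums, agreement off a null set and products with a fresh variable are the remaining closure
properties (drafted as stubs by the lead). Pure bookkeeping; no analysis.

References: J. Ayoub, Ann. of Math. 181 (2015), Rem. 1.5; J. Bochnak, M. Coste, M.-F. Roy, *Real Algebraic Geometry*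
(1998), §2.1; M. Kontsevich, D. Zagier, *Periods* (2001), §1.2.
-/

noncomputable section

set_option linter.dupNamespace false

namespace Summit.KontsevichZagierPeriods.KontsevichZagierPeriods.Cruxes.StokesGeneration.FibrewiseStokes

open MeasureTheory Set
open Literature.NumberTheory.Transcendental
open Literature.NumberTheory.Transcendental.KZ
open Literature.ModelTheory.ExponentialFields (IsSemialgebraic)

/-- **A single fibrewise Stokes element is decomposable** (`J = 1`, no padding, empty null set). [folklore] -/
theorem fibStokesDecomposable_element :
    ∀ (M : ℕ) (i : Fin M) (G D : (Fin M → ℝ) → ℝ) (K : Set (Fin M → ℝ)) (q : IntegralRep M),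
      IsSemialgebraicFunOn ℚ (Set.pi Set.univ (fun _ : Fin M => Set.Icc (0:ℝ) 1)) G →
      IsSemialgebraicFunOn ℚ (Set.pi Set.univ (fun _ : Fin M => Set.Icc (0:ℝ) 1)) D →
      IsSemialgebraic ℚ K →
      (∃ B : ℝ, ∀ x ∈ Set.pi Set.univ (fun _ : Fin M => Set.Icc (0:ℝ) 1), |G x| ≤ B) →
      (∀ x ∈ Set.pi Set.univ (fun _ : Fin M => Set.Icc (0:ℝ) 1), Set.Finite {s : ℝ | Function.update x i s ∈ K}) →
      (∀ x ∈ Set.pi Set.univ (fun _ : Fin M => Set.Icc (0:ℝ) 1),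
        ContinuousOn (fun s : ℝ => G (Function.update x i s)) (Set.Icc (0:ℝ) 1)) →
      (∀ x ∈ Set.pi Set.univ (fun _ : Fin M => Set.Icc (0:ℝ) 1), x ∉ K → x i ∈ Set.Ioo (0:ℝ) 1 →
        HasDerivAt (fun s : ℝ => G (Function.update x i s)) (D x) (x i)) →
      q.domain = Set.pi Set.univ (fun _ : Fin M => Set.Icc (0:ℝ) 1) →
      (∀ x ∈ Set.pi Set.univ (fun _ : Fin M => Set.Icc (0:ℝ) 1),
        q.integrand x = D x - (G (Function.update x i 1) - G (Function.update x i 0))) →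
      FibStokesDecomposable M q.integrand := by
  intro M i G D K q hG hD hK hB hfin hcont hder hqd hqi
  refine ⟨M, le_rfl, 1, fun _ => i, fun _ => G, fun _ => D, fun _ => K, fun _ => q, ∅,
    fun _ => ⟨hG, hD, hK, hB, hfin, hcont, hder⟩, fun _ => ⟨hqd, hqi⟩,
    Literature.ModelTheory.ExponentialFields.isSemialgebraic_empty, measure_empty, fun x _ _ => ?_⟩
  simp

/-- **Negation.** The class of fibrewise-Stokes decomposable functions is stable under `h ↦ −h` (negate every
primitive and derivative; the carried representations are `IntegralRep.neg`). [folklore] -/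
theorem fibStokesDecomposable_neg :
    ∀ (M : ℕ) (h : (Fin M → ℝ) → ℝ), FibStokesDecomposable M h → FibStokesDecomposable M (fun x => -h x) := by
  intro M h ⟨M', hMM', J, i, G, D, K, q, Z, hpack, hq, hZs, hZ0, hid⟩
  refine ⟨M', hMM', J, i, fun j x => -G j x, fun j x => -D j x, K, fun j => (q j).neg, Z, fun j => ?_,
    fun j => ⟨by rw [IntegralRep.domain_neg, (hq j).1], fun x hx => ?_⟩, hZs, hZ0, fun x hx hxZ => ?_⟩
  · obtain ⟨h1, h2, h3, ⟨B, hB⟩, h5, h6, h7⟩ := hpack j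
    exact ⟨h1.fun_neg, h2.fun_neg, h3, ⟨B, fun x hx => by rw [abs_neg]; exact hB x hx⟩, h5,
      fun x hx => (h6 x hx).neg, fun x hx hxK hxj => (h7 x hx hxK hxj).neg⟩
  · show -(q j).integrand x = _
    rw [(hq j).2 x hx]; ring
  · show -h (fun l => x (Fin.castLE hMM' l)) = ∑ j, (q j).neg.integrand x
    rw [hid x hx hxZ, ← Finset.sum_neg_distrib]
    rfl

/-- Updating a coordinate commutes with relabelling coordinates along a permutation. [folklore] -/
theorem comp_perm_update {M' : ℕ} (τ : Equiv.Perm (Fin M')) (y : Fin M' → ℝ) (a : Fin M') (s : ℝ) :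
    (fun k => Function.update y (τ a) s (τ k)) = Function.update (fun k => y (τ k)) a s := by
  ext k
  by_cases hk : k = a
  · subst hk; simp
  · rw [Function.update_of_ne hk, Function.update_of_ne (fun h => hk (τ.injective h))]

/-- **Coordinate permutations (registered stub `fibStokesDecomposable_perm`).** The decomposition is transported along the permutation of the padded
cube that extends `σ` by the identity on the padding coordinates (`Equiv.Perm.extendDomain`); the carried
representations are the coordinate relabellings `IntegralRep.reindex`, the null set is a coordinate preimage
(measure preserving). [folklore] -/
theorem fibStokesDecomposable_perm :
    ∀ (M : ℕ) (σ : Equiv.Perm (Fin M)) (h : (Fin M → ℝ) → ℝ), FibStokesDecomposable M h →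
      FibStokesDecomposable M (fun x => h (fun l => x (σ l))) := by
  classical
  intro M σ h ⟨M', hMM', J, i, G, D, K, q, Z, hpack, hq, hZs, hZ0, hid⟩
  -- extend `σ` to a permutation `τ` of `Fin M'` fixing the padding coordinates
  let emb : Fin M ≃ {b : Fin M' // b ∈ Set.range (Fin.castLE hMM')} :=
    Equiv.ofInjective (Fin.castLE hMM') (Fin.castLE_injective hMM') |>.trans (Equiv.refl _)
  let τ : Equiv.Perm (Fin M') := σ.extendDomain emb
  have hemb : ∀ l : Fin M, ((emb l : {b : Fin M' // b ∈ Set.range (Fin.castLE hMM')}) : Fin M') =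
      Fin.castLE hMM' l := fun l => rfl
  have hτ : ∀ l : Fin M, τ (Fin.castLE hMM' l) = Fin.castLE hMM' (σ l) := fun l => by
    rw [← hemb l, Equiv.Perm.extendDomain_apply_image σ emb l, hemb]
  -- the coordinate relabelling `φ y = y ∘ τ` of the padded cube
  set S : Set (Fin M' → ℝ) := Set.pi Set.univ (fun _ : Fin M' => Set.Icc (0:ℝ) 1) with hS
  have hφS : ∀ y ∈ S, (fun k => y (τ k)) ∈ S := fun y hy k _ => hy (τ k) (Set.mem_univ _)
  have hSτ : {w : Fin M' → ℝ | (fun k => w (τ k)) ∈ S} = S := by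
    ext w
    refine ⟨fun hw k _ => ?_, fun hw => hφS w hw⟩
    have := hw (τ.symm k) (Set.mem_univ _)
    simpa using this
  refine ⟨M', hMM', J, fun j => τ (i j), fun j y => G j (fun k => y (τ k)), fun j y => D j (fun k => y (τ k)),
    fun j => {y | (fun k => y (τ k)) ∈ K j}, fun j => (q j).reindex τ, {y | (fun k => y (τ k)) ∈ Z},
    fun j => ?_, fun j => ⟨?_, fun y hy => ?_⟩, hZs.preimage_comp τ, ?_, fun y hy hyZ => ?_⟩
  · obtain ⟨h1, h2, h3, ⟨B, hB⟩, h5, h6, h7⟩ := hpack j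
    refine ⟨?_, ?_, h3.preimage_comp τ, ⟨B, fun y hy => hB _ (hφS y hy)⟩, fun y hy => ?_, fun y hy => ?_,
      fun y hy hyK hyj => ?_⟩
    · simpa only [hSτ] using h1.comp_equiv τ
    · simpa only [hSτ] using h2.comp_equiv τ
    · have := h5 _ (hφS y hy)
      refine (this.subset fun s hs => ?_)
      simp only [Set.mem_setOf_eq] at hs ⊢
      rwa [← comp_perm_update τ y (i j) s]
    · have := h6 _ (hφS y hy)
      refine this.congr fun s _ => ?_
      show G j (fun k => Function.update y (τ (i j)) s (τ k)) = G j (Function.update (fun k => y (τ k)) (i j) s)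
      rw [comp_perm_update]
    · have hK : (fun k => y (τ k)) ∉ K j := hyK
      have hd := h7 _ (hφS y hy) hK hyj
      refine (hd.congr_of_eventuallyEq (Filter.Eventually.of_forall fun s => ?_))
      show G j (fun k => Function.update y (τ (i j)) s (τ k)) = G j (Function.update (fun k => y (τ k)) (i j) s)
      rw [comp_perm_update]
  · rw [IntegralRep.reindex_domain, (hq j).1]
    exact hSτ
  · rw [IntegralRep.reindex_integrand]
    show (q j).integrand (fun k => y (τ k)) = D j (fun k => y (τ k)) -
      (G j (fun k => Function.update y (τ (i j)) 1 (τ k)) - G j (fun k => Function.update y (τ (i j)) 0 (τ k)))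
    rw [(hq j).2 _ (hφS y hy), comp_perm_update, comp_perm_update]
  · -- the relabelled null set is null (coordinate permutations preserve Lebesgue measure)
    have hmp : MeasurePreserving (MeasurableEquiv.piCongrLeft (fun _ : Fin M' => ℝ) τ.symm)
        (volume : Measure (Fin M' → ℝ)) (volume : Measure (Fin M' → ℝ)) :=
      volume_measurePreserving_piCongrLeft (fun _ : Fin M' => ℝ) τ.symm
    have happ : ∀ w : Fin M' → ℝ,
        MeasurableEquiv.piCongrLeft (fun _ : Fin M' => ℝ) τ.symm w = fun k => w (τ k) := by
      intro w; ext k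
      simpa using MeasurableEquiv.piCongrLeft_apply_apply τ.symm (β := fun _ : Fin M' => ℝ) w (τ k)
    have hset : {y : Fin M' → ℝ | (fun k => y (τ k)) ∈ Z} =
        (MeasurableEquiv.piCongrLeft (fun _ : Fin M' => ℝ) τ.symm) ⁻¹' Z := by
      ext w; rw [Set.mem_preimage, happ, Set.mem_setOf_eq]
    rw [hset, hmp.measure_preimage_equiv, hZ0]
  · have hyZ' : (fun k => y (τ k)) ∉ Z := hyZ
    have := hid _ (hφS y hy) hyZ'
    have hproj : (fun l => (fun k => y (τ k)) (Fin.castLE hMM' l)) = fun l => y (Fin.castLE hMM' (σ l)) := by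
      ext l; simp only [hτ]
    rw [hproj] at this
    simp only [IntegralRep.reindex_integrand]
    exact this

end Summit.KontsevichZagierPeriods.KontsevichZagierPeriods.Cruxes.StokesGeneration.FibrewiseStokes

end
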